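import Summits.Parity.GeneralizedHardyLittlewood.Theorems.DicksonFibrationDimOneDefs
import Summits.Parity.GeneralizedHardyLittlewood.Theorems.LeeYangFibresAbsoluteUpgradeSinglesDecaySeq
import Literature.NumberTheory.Sieve.SieveFramework
import HarnessLib

/-!
# Route `DicksonFibration`, crux `DimOne` (stmt-Parity-0819), line `birth` (sieve-model reshape):
# helper file 1 for the stub `stub_primeSieve` — the dictionary of a WEIGHTED value sequence

Tools for the registered stub `stub_primeSieve : PrimeSieve` (file
`Theorems/DicksonFibrationDimOneStubPrimeSieve.lean`): the one-prime sifted sum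
`Σ_{m ∈ I : (ψ_k(m), P) = 1 ∀ k ≠ i} Λ(ψ_i(m))` is the sifting function of the sequence ON THE VALUES
`v = F(m)`, `F = ∏_{k ≠ i} (a_k X + b_k)`, with the WEIGHTS `Λ(ψ_i(m))`:

* for any sifted sequence `𝒜` whose weights are `a_v = Σ_{n ∈ S : F(n) = v} w(n)` (the tree's
  `AbsoluteUpgrade.valSeq` is the case `w = 1`): `sifted_eq_of_eq` (`S(𝒜, P; x) = Σ_{n ∈ S : (F(n), P) = 1} w(n)`
  once `0 < F(n) ≤ x` on `S`), `congrSum_eq_of_eq` (`A_d(x) = Σ_{n ∈ S : d ∣ F(n)} w(n)`),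
  and `sum_filter_dvd_eval_eq_sum_rootsMod`
  (`Σ_{n ∈ S : d ∣ F(n)} w(n) = Σ_{s mod d : d ∣ F(s)} Σ_{n ∈ S : n ≡ s (d)} w(n)`), whence
  `remainder_eq_of_eq`;
* `sum_intVonMangoldt_filter_dvd_le` (registered sub-goal) — **one prime in a form**: for a prime `q`
  and a form `a m + b` (`a ≠ 0`) with values in `[1, x]` on `I`,
  `Σ_{m ∈ I : q ∣ a m + b} Λ(a m + b) ≤ (log x/log 2 + 1) log x` (only the powers `q^j ≤ x` contribute);
* `abs_sum_classSum_sub_le` — the remainder of the weighted sequence at a modulus `d`, class by class: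
  with `CS(s) = Σ_{m ∈ I : m ≡ s (d)} Λ(a m + b)`,
  `|Σ_{s : d ∣ F(s)} CS(s) − #{good s} E| ≤ Σ_{good s} |CS(s) − E| + d (log x/log 2 + 1) log x`, where
  `s` is GOOD when `(a s + b, d) = 1` (a bad class only carries powers of one prime `q ∣ d`).

References: H. Halberstam, H.-E. Richert, *Sieve Methods* (1974), Ch. 1, Examples 3 and 5, and
Thm. 2.5 [HalberstamRichert1974].
-/

noncomputable section

open scoped BigOperators Classical
open Finset Polynomial Literature.NumberTheory.Sieve
open Summit.Parity.GeneralizedHardyLittlewood.Theorems.AbsoluteUpgrade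

namespace Summit.Parity.GeneralizedHardyLittlewood.Cruxes.DimOne.BirthSieve

/-! ### The weighted value sequence: dictionary -/

section Dictionary

variable {F : ℤ[X]} {w : ℤ → ℝ} {S : Finset ℤ} {A : SieveSequence}

/-- **Summing through the values.** For a sifted sequence with weights
`a_v = Σ_{n ∈ S : F(n) = v} w(n)` and `0 < F(n) ≤ x` on `S`: for any property `Q` of the value,
`Σ_{1 ≤ v ≤ x, Q(v)} a_v = Σ_{n ∈ S : Q(|F(n)|)} w(n)`. [folklore] -/
theorem sum_filter_a_eq_of_eq
    (hAa : ∀ v : ℕ, A.a v = ∑ n ∈ S.filter (fun n : ℤ => F.eval n = (v : ℤ)), w n)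
    {x : ℝ} (hx : ∀ n ∈ S, 0 < F.eval n ∧ ((F.eval n : ℤ) : ℝ) ≤ x) (Q : ℕ → Prop) [DecidablePred Q] :
    ∑ v ∈ (Ioc 0 ⌊x⌋₊).filter Q, A.a v = ∑ n ∈ S.filter (fun n : ℤ => Q (F.eval n).natAbs), w n := by
  -- adapted from `AbsoluteUpgrade.sum_filter_valSeq_a_eq_card` (the case `w = 1`)
  simp only [hAa]
  have hfib : ∀ v : ℕ, (S.filter fun n : ℤ => F.eval n = (v : ℤ)) =
      S.filter fun n : ℤ => (F.eval n).natAbs = v := by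
    intro v
    refine Finset.filter_congr fun n hn => ?_
    have h0 := (hx n hn).1
    constructor
    · intro h; rw [h, Int.natAbs_natCast]
    · intro h; rw [← h, Int.natAbs_of_nonneg h0.le]
  simp_rw [hfib]
  have hmaps : ∀ n ∈ S.filter (fun n : ℤ => Q (F.eval n).natAbs),
      (F.eval n).natAbs ∈ (Ioc 0 ⌊x⌋₊).filter Q := by
    intro n hn
    rw [Finset.mem_filter] at hn
    obtain ⟨h0, hle⟩ := hx n hn.1
    refine Finset.mem_filter.mpr ⟨Finset.mem_Ioc.mpr ⟨Int.natAbs_pos.mpr h0.ne', ?_⟩, hn.2⟩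
    refine Nat.le_floor ?_
    have : (((F.eval n).natAbs : ℤ) : ℝ) = ((F.eval n : ℤ) : ℝ) := by
      rw [Int.natAbs_of_nonneg h0.le]
    rw [← Int.cast_natCast, this]
    exact hle
  rw [← Finset.sum_fiberwise_of_maps_to hmaps]
  refine Finset.sum_congr rfl fun v hv => Finset.sum_congr ?_ fun _ _ => rfl
  ext n
  simp only [Finset.mem_filter]
  constructor
  · rintro ⟨hn, hv'⟩
    exact ⟨⟨hn, by rw [hv']; exact (Finset.mem_filter.mp hv).2⟩, hv'⟩
  · rintro ⟨⟨hn, -⟩, hv'⟩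
    exact ⟨hn, hv'⟩

/-- **The sifting function:** `S(𝒜, P; x) = Σ_{n ∈ S : (F(n), P) = 1} w(n)` once `0 < F(n) ≤ x` on `S`.
[folklore] -/
theorem sifted_eq_of_eq (hAa : ∀ v : ℕ, A.a v = ∑ n ∈ S.filter (fun n : ℤ => F.eval n = (v : ℤ)), w n)
    {x : ℝ} (hx : ∀ n ∈ S, 0 < F.eval n ∧ ((F.eval n : ℤ) : ℝ) ≤ x) (P : ℕ) :
    A.sifted x P = ∑ n ∈ S.filter (fun n : ℤ => (F.eval n).natAbs.Coprime P), w n :=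
  sum_filter_a_eq_of_eq hAa hx _

/-- **The congruence sums:** `A_d(x) = Σ_{n ∈ S : d ∣ F(n)} w(n)` once `0 < F(n) ≤ x` on `S`.
[folklore] -/
theorem congrSum_eq_of_eq (hAa : ∀ v : ℕ, A.a v = ∑ n ∈ S.filter (fun n : ℤ => F.eval n = (v : ℤ)), w n)
    {x : ℝ} (hx : ∀ n ∈ S, 0 < F.eval n ∧ ((F.eval n : ℤ) : ℝ) ≤ x) (d : ℕ) :
    A.congrSum d x = ∑ n ∈ S.filter (fun n : ℤ => (d : ℤ) ∣ F.eval n), w n := by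
  rw [SieveSequence.congrSum, sum_filter_a_eq_of_eq hAa hx]
  refine Finset.sum_congr (Finset.filter_congr fun n _ => ?_) fun _ _ => rfl
  exact Int.natCast_dvd.symm

/-- **Partition by the residue modulo `d ≥ 1`:**
`Σ_{n ∈ S : d ∣ F(n)} w(n) = Σ_{0 ≤ s < d : d ∣ F(s)} Σ_{n ∈ S : n ≡ s (mod d)} w(n)`. [folklore] -/
theorem sum_filter_dvd_eval_eq_sum_rootsMod (F : ℤ[X]) (w : ℤ → ℝ) (S : Finset ℤ) {d : ℕ}
    (hd : 0 < d) :
    ∑ n ∈ S.filter (fun n : ℤ => (d : ℤ) ∣ F.eval n), w n =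
      ∑ s ∈ rootsMod F d, ∑ n ∈ S.filter (fun n : ℤ => n ≡ (s : ℤ) [ZMOD d]), w n := by
  -- adapted from `AbsoluteUpgrade.card_filter_dvd_eval_eq_sum` (the case `w = 1`)
  have hd0 : (d : ℤ) ≠ 0 := by exact_mod_cast hd.ne'
  have hres : ∀ n : ℤ, (((n % d).toNat : ℕ) : ℤ) = n % d := fun n =>
    Int.toNat_of_nonneg (Int.emod_nonneg n hd0)
  have hreslt : ∀ n : ℤ, (n % d).toNat < d := fun n => by
    have h := Int.emod_lt_of_pos n (by exact_mod_cast hd : (0 : ℤ) < d)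
    omega
  have hmodEq : ∀ n : ℤ, n ≡ (((n % d).toNat : ℕ) : ℤ) [ZMOD d] := fun n => by
    rw [hres, Int.ModEq, Int.emod_emod_of_dvd n (dvd_refl (d : ℤ))]
  have hmaps : ∀ n ∈ S.filter (fun n : ℤ => (d : ℤ) ∣ F.eval n), (n % d).toNat ∈ rootsMod F d := by
    intro n hn
    rw [Finset.mem_filter] at hn
    rw [mem_rootsMod]
    exact ⟨hreslt n, (dvd_eval_iff_of_modEq F (hmodEq n)).mp hn.2⟩
  rw [← Finset.sum_fiberwise_of_maps_to hmaps]
  refine Finset.sum_congr rfl fun s hs => Finset.sum_congr ?_ fun _ _ => rfl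
  obtain ⟨hsd, hsroot⟩ := mem_rootsMod.mp hs
  ext n
  simp only [Finset.mem_filter]
  constructor
  · rintro ⟨⟨hn, -⟩, hmod⟩
    refine ⟨hn, ?_⟩
    have := hmodEq n
    rwa [hmod] at this
  · rintro ⟨hn, hmod⟩
    have hs' : (n % d).toNat = s := by
      have h2 : (s : ℤ) % (d : ℤ) = s :=
        Int.emod_eq_of_lt (Int.natCast_nonneg s) (by exact_mod_cast hsd)
      have h1 : n % (d : ℤ) = (s : ℤ) % (d : ℤ) := hmod
      rw [h2] at h1
      rw [h1, Int.toNat_natCast]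
    exact ⟨⟨hn, (dvd_eval_iff_of_modEq F hmod).mpr hsroot⟩, hs'⟩

/-- **The remainder, class by class:** for `d ≥ 1` and `0 < F(n) ≤ x` on `S`,
`R_d(x) = Σ_{0 ≤ s < d : d ∣ F(s)} Σ_{n ∈ S : n ≡ s (mod d)} w(n) − g(d) X(x)`. [folklore] -/
theorem remainder_eq_of_eq (hAa : ∀ v : ℕ, A.a v = ∑ n ∈ S.filter (fun n : ℤ => F.eval n = (v : ℤ)), w n)
    {x : ℝ} (hx : ∀ n ∈ S, 0 < F.eval n ∧ ((F.eval n : ℤ) : ℝ) ≤ x) {d : ℕ} (hd : 0 < d) :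
    A.remainder d x =
      (∑ s ∈ rootsMod F d, ∑ n ∈ S.filter (fun n : ℤ => n ≡ (s : ℤ) [ZMOD d]), w n) -
        A.density d * A.size x := by
  rw [SieveSequence.remainder, congrSum_eq_of_eq hAa hx, sum_filter_dvd_eval_eq_sum_rootsMod F w S hd]

end Dictionary

/-! ### One prime in a form -/

/-- **One prime in a form** (registered sub-goal of stmt-Parity-0819, helper for `stub_primeSieve`).
For a prime `q` and a form `a m + b` (`a ≠ 0`) with `1 ≤ a m + b ≤ x` on the finite set `I`
(`x ≥ 1`): `Σ_{m ∈ I : q ∣ a m + b} Λ(a m + b) ≤ (log x/log 2 + 1) log x` — only the values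
`a m + b = q^j ≤ x`, `1 ≤ j ≤ log x/log 2`, contribute, each at most `log x`, and `m ↦ a m + b` is
injective. [folklore] -/
theorem sum_intVonMangoldt_filter_dvd_le : ∀ {a b : ℤ}, a ≠ 0 → ∀ {q : ℕ}, q.Prime → ∀ (I : Finset ℤ) {x : ℝ}, 1 ≤ x → (∀ m ∈ I, 1 ≤ a * m + b) → (∀ m ∈ I, ((a * m + b : ℤ) : ℝ) ≤ x) → ∑ m ∈ I.filter (fun m : ℤ => (q : ℤ) ∣ a * m + b), Literature.NumberTheory.Sieve.intVonMangoldt (a * m + b) ≤ (Real.log x / Real.log 2 + 1) * Real.log x := by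
  intro a b ha q hq I x hx hpos hle
  have hlog0 : 0 ≤ Real.log x := Real.log_nonneg hx
  have hlog2 : 0 < Real.log 2 := Real.log_pos one_lt_two
  set K : ℕ := ⌊Real.log x / Real.log 2⌋₊ with hK
  set T := (I.filter (fun m : ℤ => (q : ℤ) ∣ a * m + b)).filter
    (fun m : ℤ => IsPrimePow (a * m + b).toNat) with hT
  -- only prime powers carry `Λ`
  have hsum : ∑ m ∈ I.filter (fun m : ℤ => (q : ℤ) ∣ a * m + b), intVonMangoldt (a * m + b) =
      ∑ m ∈ T, intVonMangoldt (a * m + b) := by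
    rw [hT]
    symm
    refine Finset.sum_filter_of_ne fun m _ hne => ?_
    exact ArithmeticFunction.vonMangoldt_ne_zero_iff.mp hne
  -- the values on `T` are powers `q^j`, `j ≤ K`
  have hval : ∀ m ∈ T, ∃ j ∈ range (K + 1), (a * m + b).toNat = q ^ j := by
    intro m hm
    rw [hT, Finset.mem_filter, Finset.mem_filter] at hm
    obtain ⟨⟨hmI, hqd⟩, hpp⟩ := hm
    obtain ⟨p, k, hp, hk, hpk⟩ := (isPrimePow_nat_iff _).mp hpp
    have hv1 := hpos m hmI
    have hvnat : ((a * m + b).toNat : ℤ) = a * m + b := Int.toNat_of_nonneg (by omega)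
    have hqv : q ∣ (a * m + b).toNat := by
      rw [← Int.natCast_dvd_natCast, hvnat]; exact hqd
    rw [← hpk] at hqv
    have hqp : q = p := (Nat.prime_dvd_prime_iff_eq hq hp).mp (hq.dvd_of_dvd_pow hqv)
    subst hqp
    refine ⟨k, Finset.mem_range.mpr (Nat.lt_succ_of_le ?_), hpk.symm⟩
    -- `k log 2 ≤ k log q = log (q^k) ≤ log x`
    refine Nat.le_floor ?_
    rw [le_div_iff₀ hlog2]
    have hq2 : (2 : ℝ) ≤ q := by exact_mod_cast hq.two_le
    have hvx : ((q : ℝ) ^ k) ≤ x := by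
      have h1 : (((a * m + b).toNat : ℕ) : ℝ) ≤ x := by
        have := hle m hmI
        rwa [← hvnat, Int.cast_natCast] at this
      have h2 : ((q ^ k : ℕ) : ℝ) ≤ x := by rw [hpk]; exact h1
      exact_mod_cast h2
    calc (k : ℝ) * Real.log 2 ≤ (k : ℝ) * Real.log q :=
          mul_le_mul_of_nonneg_left (Real.log_le_log two_pos hq2) (Nat.cast_nonneg k)
      _ = Real.log ((q : ℝ) ^ k) := (Real.log_pow (q : ℝ) k).symm
      _ ≤ Real.log x := Real.log_le_log (by positivity) hvx
  -- hence at most `K + 1` of them (the form is injective)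
  have hcard : #T ≤ K + 1 := by
    calc #T ≤ #((range (K + 1)).image (fun j => q ^ j)) := by
          refine Finset.card_le_card_of_injOn (fun m => (a * m + b).toNat) (fun m hm => ?_) ?_
          · obtain ⟨j, hj, hmj⟩ := hval m hm
            exact Finset.mem_coe.mpr (Finset.mem_image.mpr ⟨j, hj, hmj.symm⟩)
          · intro m hm m' hm' hmm'
            have h1 := hpos m (Finset.mem_filter.mp (Finset.mem_filter.mp hm).1).1
            have h2 := hpos m' (Finset.mem_filter.mp (Finset.mem_filter.mp hm').1).1
            have e1 : ((a * m + b).toNat : ℤ) = a * m + b := Int.toNat_of_nonneg (by omega)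
            have e2 : ((a * m' + b).toNat : ℤ) = a * m' + b := Int.toNat_of_nonneg (by omega)
            have h3 : a * m + b = a * m' + b := by
              rw [← e1, ← e2]; exact congrArg (fun n : ℕ => (n : ℤ)) hmm'
            exact mul_left_cancel₀ ha (by linarith)
      _ ≤ #(range (K + 1)) := Finset.card_image_le
      _ = K + 1 := Finset.card_range _
  -- each term is at most `log x`
  have hterm : ∀ m ∈ T, intVonMangoldt (a * m + b) ≤ Real.log x := by
    intro m hm
    have hmI := (Finset.mem_filter.mp (Finset.mem_filter.mp hm).1).1
    have hv1 := hpos m hmI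
    have hvnat : ((a * m + b).toNat : ℤ) = a * m + b := Int.toNat_of_nonneg (by omega)
    have h1 : (((a * m + b).toNat : ℕ) : ℝ) ≤ x := by
      have := hle m hmI
      rwa [← hvnat, Int.cast_natCast] at this
    have h0 : (0 : ℝ) < ((a * m + b).toNat : ℕ) := by
      have : 0 < (a * m + b).toNat := by omega
      exact_mod_cast this
    exact ArithmeticFunction.vonMangoldt_le_log.trans (Real.log_le_log h0 h1)
  have hK1 : ((K + 1 : ℕ) : ℝ) ≤ Real.log x / Real.log 2 + 1 := by
    push_cast
    linarith [Nat.floor_le (show 0 ≤ Real.log x / Real.log 2 by positivity)]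
  rw [hsum]
  calc ∑ m ∈ T, intVonMangoldt (a * m + b) ≤ ∑ _m ∈ T, Real.log x := Finset.sum_le_sum hterm
    _ = #T * Real.log x := by rw [Finset.sum_const, nsmul_eq_mul]
    _ ≤ ((K + 1 : ℕ) : ℝ) * Real.log x := by
        exact mul_le_mul_of_nonneg_right (by exact_mod_cast hcard) hlog0
    _ ≤ (Real.log x / Real.log 2 + 1) * Real.log x := mul_le_mul_of_nonneg_right hK1 hlog0

/-! ### The remainder at a square-free modulus, class by class -/

/-- A BAD root class `s` (`(a s + b, d) > 1`) only carries powers of one prime `q ∣ d`: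
`Σ_{m ∈ I : m ≡ s (d)} Λ(a m + b) ≤ (log x/log 2 + 1) log x` (values in `[1, x]`, `x ≥ 1`). [folklore] -/
theorem classSum_le_of_gcd_ne_one {a b : ℤ} (ha : a ≠ 0) (d : ℕ) (I : Finset ℤ) {x : ℝ}
    (hx : 1 ≤ x) (hpos : ∀ m ∈ I, 1 ≤ a * m + b) (hle : ∀ m ∈ I, ((a * m + b : ℤ) : ℝ) ≤ x)
    {s : ℕ} (hs : Int.gcd (a * s + b) d ≠ 1) :
    ∑ m ∈ I.filter (fun m : ℤ => m ≡ (s : ℤ) [ZMOD d]), intVonMangoldt (a * m + b) ≤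
      (Real.log x / Real.log 2 + 1) * Real.log x := by
  -- a prime `q ∣ gcd(a s + b, d)`
  set q := (Int.gcd (a * s + b) d).minFac with hq
  have hqp : q.Prime := Nat.minFac_prime hs
  have hqg : q ∣ Int.gcd (a * s + b) d := Nat.minFac_dvd _
  have hqd : q ∣ d := by
    have h : Int.gcd (a * s + b) d ∣ d := by
      have := Int.gcd_dvd_right (a * ↑s + b) d
      exact_mod_cast this
    exact hqg.trans h
  have hqs : (q : ℤ) ∣ a * s + b :=
    (Int.natCast_dvd_natCast.mpr hqg).trans (Int.gcd_dvd_left _ _)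
  -- the class is contained in `{m : q ∣ a m + b}`
  have hsub : I.filter (fun m : ℤ => m ≡ (s : ℤ) [ZMOD d]) ⊆
      I.filter (fun m : ℤ => (q : ℤ) ∣ a * m + b) := by
    intro m hm
    rw [Finset.mem_filter] at hm ⊢
    refine ⟨hm.1, ?_⟩
    have h1 : a * m + b ≡ a * s + b [ZMOD q] :=
      ((hm.2.of_dvd (Int.natCast_dvd_natCast.mpr hqd)).mul_left a).add_right b
    exact (Int.ModEq.dvd_iff h1).mpr hqs
  exact (Finset.sum_le_sum_of_subset_of_nonneg hsub fun m _ _ =>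
    ArithmeticFunction.vonMangoldt_nonneg).trans
    (sum_intVonMangoldt_filter_dvd_le ha hqp I hx hpos hle)

/-- **The remainder, class by class.** For a modulus `d`, a form `a m + b` (`a ≠ 0`) with values in `[1, x]`
on `I` (`x ≥ 1`) and any expected mass `E` per good class: with `CS(s) = Σ_{m ∈ I : m ≡ s (d)} Λ(a m + b)`,
`|Σ_{s : d ∣ F(s)} CS(s) − #{good s} · E| ≤ Σ_{good s} |CS(s) − E| + d (log x/log 2 + 1) log x`
(the `≤ ω_F(d) ≤ d` bad classes each carry at most `(log x/log 2 + 1) log x`). [folklore] -/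
theorem abs_sum_classSum_sub_le (F : ℤ[X]) {a b : ℤ} (ha : a ≠ 0) (d : ℕ) (I : Finset ℤ)
    {x : ℝ} (hx : 1 ≤ x) (hpos : ∀ m ∈ I, 1 ≤ a * m + b) (hle : ∀ m ∈ I, ((a * m + b : ℤ) : ℝ) ≤ x)
    (E : ℝ) :
    |∑ s ∈ rootsMod F d, ∑ m ∈ I.filter (fun m : ℤ => m ≡ (s : ℤ) [ZMOD d]), intVonMangoldt (a * m + b) -
        (#((rootsMod F d).filter (fun s : ℕ => Int.gcd (a * s + b) d = 1)) : ℝ) * E| ≤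
      ∑ s ∈ (rootsMod F d).filter (fun s : ℕ => Int.gcd (a * s + b) d = 1),
          |∑ m ∈ I.filter (fun m : ℤ => m ≡ (s : ℤ) [ZMOD d]), intVonMangoldt (a * m + b) - E| +
        d * ((Real.log x / Real.log 2 + 1) * Real.log x) := by
  set CS : ℕ → ℝ := fun s => ∑ m ∈ I.filter (fun m : ℤ => m ≡ (s : ℤ) [ZMOD d]),
    intVonMangoldt (a * m + b) with hCS
  set good := (rootsMod F d).filter (fun s : ℕ => Int.gcd (a * s + b) d = 1) with hgood
  set bad := (rootsMod F d).filter (fun s : ℕ => ¬ Int.gcd (a * s + b) d = 1) with hbad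
  set Θ := (Real.log x / Real.log 2 + 1) * Real.log x with hΘ
  have hsplit : ∑ s ∈ rootsMod F d, CS s = ∑ s ∈ good, CS s + ∑ s ∈ bad, CS s :=
    (Finset.sum_filter_add_sum_filter_not _ _ _).symm
  have hCS0 : ∀ s, 0 ≤ CS s := fun s =>
    Finset.sum_nonneg fun m _ => ArithmeticFunction.vonMangoldt_nonneg
  have hΘ0 : 0 ≤ Θ := by
    have hlog0 : 0 ≤ Real.log x := Real.log_nonneg hx
    have hlog2 : 0 < Real.log 2 := Real.log_pos one_lt_two
    positivity
  -- the bad classes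
  have hbadle : ∑ s ∈ bad, CS s ≤ d * Θ := by
    have h1 : ∀ s ∈ bad, CS s ≤ Θ := fun s hs =>
      classSum_le_of_gcd_ne_one ha d I hx hpos hle (Finset.mem_filter.mp hs).2
    have hcard : (#bad : ℝ) ≤ d := by
      have h2 : #bad ≤ #(rootsMod F d) := Finset.card_le_card (Finset.filter_subset _ _)
      rw [card_rootsMod] at h2
      exact_mod_cast h2.trans (polyRootCountMod_le _ d)
    calc ∑ s ∈ bad, CS s ≤ ∑ _s ∈ bad, Θ := Finset.sum_le_sum h1
      _ = #bad * Θ := by rw [Finset.sum_const, nsmul_eq_mul]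
      _ ≤ d * Θ := mul_le_mul_of_nonneg_right hcard hΘ0
  -- the good classes
  have hgoodeq : ∑ s ∈ good, CS s - (#good : ℝ) * E = ∑ s ∈ good, (CS s - E) := by
    rw [Finset.sum_sub_distrib, Finset.sum_const, nsmul_eq_mul]
  have key : ∑ s ∈ rootsMod F d, CS s - (#good : ℝ) * E =
      ∑ s ∈ good, (CS s - E) + ∑ s ∈ bad, CS s := by
    rw [hsplit, ← hgoodeq]; ring
  rw [key]
  calc |∑ s ∈ good, (CS s - E) + ∑ s ∈ bad, CS s|
      ≤ |∑ s ∈ good, (CS s - E)| + |∑ s ∈ bad, CS s| := abs_add_le _ _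
    _ ≤ ∑ s ∈ good, |CS s - E| + ∑ s ∈ bad, CS s := by
        refine add_le_add (Finset.abs_sum_le_sum_abs _ _) (le_of_eq ?_)
        exact abs_of_nonneg (Finset.sum_nonneg fun s _ => hCS0 s)
    _ ≤ ∑ s ∈ good, |CS s - E| + d * Θ := by linarith [hbadle]

end Summit.Parity.GeneralizedHardyLittlewood.Cruxes.DimOne.BirthSieve

end
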